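import Literature.MathematicalPhysics.QuantumLattice.GrassmannMonomialFlatten
import Literature.MathematicalPhysics.QuantumLattice.GrassmannPatternCounting
import Literature.MathematicalPhysics.QuantumLattice.GrassmannPairLaplacians
import Literature.Probability.LatticeModels.KernelTreeDecay
import Literature.Probability.LatticeModels.BattleFederbushWeights
import HarnessLib

/-!
# Positions of the fields of kernel vertices; the label sums of the deletion patterns of one script

Topic `Literature/MathematicalPhysics/QuantumLattice`; the label bookkeeping of the single-scale estimate in the
Laplacian host (Benfatto–Giuliani–Mastropietro 2006, (2.67)–(2.70) and the proof of (2.77)).  The vertices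
`v : Fin n` have degrees `m_v`; their fields occupy the positions `Fin (Σ_v m_v)` (`GrassmannMonomialFlatten.lean`),
position `i` belonging to the vertex `vert i` (the block of `finSigmaFinEquiv`), and a label family `Y` is the
same as a position labelling `x = flat Y : Fin (Σ m_v) → Γ` (`flatEquiv`).

* `vert`, `blockEmb`, `card_filter_vert` (`|{i : vert i = u}| = m_u`), `flatEquiv`;
* `kerProd K x = ∏_u ‖K_u(x|_u)‖`; `cl_eq_vert_of_kerProd_ne_zero` — kernels supported on their clusters force
  `cl ∘ x = vert`;
* `lapWt` — the Laplacian step weights `½‖C|_ℓ(x_q, x_p)‖ [line {vert q, vert p} = ℓ]` along the lines;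
  `kerProd_mul_patWeight_laps` — against supported kernels the pattern weights of the type-restricted
  Laplacians `Δ_{C|ℓ}` ARE these (the type restriction becomes the consistency constraint on the positions);
* `lapWt_eq` — for distinct lines, `lapWt = [pattern consistent] · ∏_{ℓ ∈ lines} lineWt ℓ`, a product of
  two-point weights indexed by the lines, the form required by the tree-decay lemma;
* **`sum_kerProd_mul_lapWt_le`** — the tree-decay lemma `KernelTreeDecay.sum_kernelProd_lineProd_le` applied:
  with one position of the root cluster pinned, `Σ_x ∏_u ‖K_u‖ · lapWt ≤ (α/2)^k ∏_u N_u`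
  (`N_u` the anchored `L¹` norms of the kernels, `α` a bound for the row and column sums of the norms of the
  type-restricted covariances `C|_ℓ` — for replica covariances this is the one-copy row sum);
* **`sum_kerProd_sum_patWeight_le`** — the full label sum of one pattern of one script with one OUTPUT label
  pinned at `w` and the tree rooted at the cluster `cl w`:
  `Σ_Y ∏‖K‖ Σ_{W : W_i = w} weight(flat Y, ops_W(s), π) ≤ [π admissible] (α/2)^k ∏_u N_u`.

Everything is proved; no named fact.

## Sources

G. Benfatto, A. Giuliani, V. Mastropietro, Ann. Henri Poincaré 7 (2006) 809–898, (2.67)–(2.70), proof of (2.77)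
(`BenfattoGiulianiMastropietro2006`); K. Gawȩdzki, A. Kupiainen, Comm. Math. Phys. 102 (1985) 1–30, §3
(`GawedzkiKupiainen1985GrossNeveu`).
-/

noncomputable section

namespace Literature.MathematicalPhysics.QuantumLattice

open GrassmannAlgebra Finset
open Literature.Probability.LatticeModels Literature.Probability.LatticeModels.BattleFederbush

/-! ### Positions, blocks, vertex of a position -/

section Positions

variable {n : ℕ} (deg : Fin n → ℕ)

/-- The vertex of a position. [folklore] -/
def vert (i : Fin (∑ v, deg v)) : Fin n := (finSigmaFinEquiv.symm i).1

/-- The positions of the fields of the vertex `u` (its block). [folklore] -/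
def blockEmb (u : Fin n) (j : Fin (deg u)) : Fin (∑ v, deg v) := finSigmaFinEquiv ⟨u, j⟩

/-- The block of `u` lies in `u`. [folklore] -/
@[simp] theorem vert_blockEmb (u : Fin n) (j : Fin (deg u)) : vert deg (blockEmb deg u j) = u := by
  simp [vert, blockEmb]

/-- Every position is in the block of its vertex. [folklore] -/
theorem blockEmb_vert (i : Fin (∑ v, deg v)) : blockEmb deg (vert deg i) (finSigmaFinEquiv.symm i).2 = i := by
  simp [vert, blockEmb]

/-- A position of vertex `u` is in the block of `u`. [folklore] -/
theorem exists_eq_blockEmb {u : Fin n} {i : Fin (∑ v, deg v)} (h : vert deg i = u) : ∃ j, i = blockEmb deg u j := by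
  subst h
  exact ⟨_, (blockEmb_vert deg i).symm⟩

/-- Blocks are embedded. [folklore] -/
theorem blockEmb_injective (u : Fin n) : Function.Injective (blockEmb deg u) := fun j j' h => by
  have h' := finSigmaFinEquiv.injective h
  simp only [Sigma.mk.injEq, heq_eq_eq, true_and] at h'
  exact h'

/-- **The vertex `u` has `m_u` positions.** [folklore] -/
theorem card_filter_vert (u : Fin n) : (univ.filter fun i => vert deg i = u).card = deg u := by
  have h : (univ.filter fun i => vert deg i = u) = univ.map ⟨blockEmb deg u, blockEmb_injective deg u⟩ := by
    ext i
    simp only [mem_filter, mem_univ, true_and, mem_map, Function.Embedding.coeFn_mk]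
    constructor
    · intro hi
      obtain ⟨j, rfl⟩ := exists_eq_blockEmb deg hi
      exact ⟨j, rfl⟩
    · rintro ⟨j, rfl⟩
      exact vert_blockEmb deg u j
  rw [h, card_map, card_univ, Fintype.card_fin]

variable {Γ : Type*}

/-- The flattened string on a block. [folklore] -/
@[simp] theorem flat_blockEmb (Ys : ∀ v, Fin (deg v) → Γ) (u : Fin n) (j : Fin (deg u)) :
    flat Ys (blockEmb deg u j) = Ys u j :=
  flat_apply_equiv Ys u j

/-- **Label families are position labellings** (`Y ↦ flat Y`). [folklore] -/
def flatEquiv : (∀ v, Fin (deg v) → Γ) ≃ (Fin (∑ v, deg v) → Γ) where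
  toFun := flat
  invFun x := fun v j => x (blockEmb deg v j)
  left_inv Ys := by
    funext v j
    exact flat_blockEmb deg Ys v j
  right_inv x := by
    funext i
    show x (finSigmaFinEquiv ⟨_, _⟩) = x i
    rw [Sigma.eta, Equiv.apply_symm_apply]

/-- Unfolding `flatEquiv`. [folklore] -/
@[simp] theorem flatEquiv_apply (Ys : ∀ v, Fin (deg v) → Γ) : flatEquiv deg Ys = flat Ys := rfl

/-- Unfolding `flatEquiv.symm`. [folklore] -/
@[simp] theorem flatEquiv_symm_apply (x : Fin (∑ v, deg v) → Γ) (u : Fin n) (j : Fin (deg u)) :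
    (flatEquiv deg).symm x u j = x (blockEmb deg u j) := rfl

end Positions

/-! ### Kernel products and the consistency forced by the supports -/

section Kernels

variable {𝕜 : Type*} [RCLike 𝕜] {Γ : Type*} {n : ℕ} {deg : Fin n → ℕ} (K : ∀ v : Fin n, (Fin (deg v) → Γ) → 𝕜)

/-- The product of the kernel norms read off a position labelling, `∏_u ‖K_u(x|_u)‖`. [folklore] -/
def kerProd (x : Fin (∑ v, deg v) → Γ) : ℝ := ∏ u, ‖K u fun j => x (blockEmb deg u j)‖

/-- `kerProd ≥ 0`. [folklore] -/
theorem kerProd_nonneg (x : Fin (∑ v, deg v) → Γ) : 0 ≤ kerProd K x := prod_nonneg fun _ _ => norm_nonneg _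

/-- `kerProd` of a flattened family. [folklore] -/
theorem kerProd_flat (Ys : ∀ v, Fin (deg v) → Γ) : kerProd K (flat Ys) = ∏ u, ‖K u (Ys u)‖ := by
  simp only [kerProd, flat_blockEmb]

/-- **Kernels supported on their clusters force `cl ∘ x = vert`** wherever the kernel product is nonzero.
[folklore] -/
theorem cl_eq_vert_of_kerProd_ne_zero (cl : Γ → Fin n) (hK : ∀ v Yv, K v Yv ≠ 0 → ∀ j, cl (Yv j) = v)
    {x : Fin (∑ v, deg v) → Γ} (h : kerProd K x ≠ 0) (i : Fin (∑ v, deg v)) : cl (x i) = vert deg i := by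
  have hu : K (vert deg i) (fun j => x (blockEmb deg (vert deg i) j)) ≠ 0 := fun h0 =>
    h (prod_eq_zero (mem_univ (vert deg i)) (by rw [h0, norm_zero]))
  have := hK _ _ hu (finSigmaFinEquiv.symm i).2
  rwa [blockEmb_vert] at this

end Kernels

/-! ### The Laplacian step weights along the lines -/

section LapWeights

variable {𝕜 : Type*} [RCLike 𝕜] {Γ : Type*} [Fintype Γ] [DecidableEq Γ] {n : ℕ} (C : Matrix Γ Γ 𝕜) (cl : Γ → Fin n)
variable (deg : Fin n → ℕ)

/-- The **consistency predicate** of the line `ℓ`: the step `(p, q)` joins the two clusters of `ℓ`. [folklore] -/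
def lapPred (ℓ : Sym2 (Fin n)) : Fin (∑ v, deg v) × Fin (∑ v, deg v) → Bool :=
  fun pq => decide (s(vert deg pq.2, vert deg pq.1) = ℓ)

/-- The **Laplacian step weights along a list of lines**: `∏_t [step t consistent with line t] ½‖C|_{ℓ_t}(x_{q_t}, x_{p_t})‖`
(`C|_ℓ` the type-restricted covariance; zero if the pattern is too short). [folklore] -/
def lapWt : List (Sym2 (Fin n)) → List (Fin (∑ v, deg v) × Fin (∑ v, deg v)) → (Fin (∑ v, deg v) → Γ) → ℝ
  | [], _, _ => 1
  | _ :: _, [], _ => 0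
  | ℓ :: ls, pq :: π, x =>
    (if s(vert deg pq.2, vert deg pq.1) = ℓ then 1 / 2 * ‖typeRestrict C cl ℓ (x pq.2) (x pq.1)‖ else 0) * lapWt ls π x

omit [Fintype Γ] [DecidableEq Γ] in
/-- `lapWt ≥ 0`. [folklore] -/
theorem lapWt_nonneg : ∀ (ls : List (Sym2 (Fin n))) (π : List (Fin (∑ v, deg v) × Fin (∑ v, deg v))) (x : Fin (∑ v, deg v) → Γ),
    0 ≤ lapWt C cl deg ls π x
  | [], _, _ => zero_le_one
  | _ :: _, [], _ => le_rfl
  | ℓ :: ls, pq :: π, x => mul_nonneg (by split_ifs <;> positivity) (lapWt_nonneg ls π x)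

omit [Fintype Γ] in
/-- Against a labelling with `cl ∘ x = vert`, the pattern weights of the type-restricted Laplacians are `lapWt`.
[folklore] -/
theorem patWeight_laps_eq_lapWt (x : Fin (∑ v, deg v) → Γ) (hx : ∀ i, cl (x i) = vert deg i) :
    ∀ (ls : List (Sym2 (Fin n))) (π : List (Fin (∑ v, deg v) × Fin (∑ v, deg v))),
      patWeight x (ls.map fun ℓ => (DelOp.lap (typeRestrict C cl ℓ) : DelOp Γ 𝕜)) π = lapWt C cl deg ls π x
  | [], π => by rw [List.map_nil, patWeight, lapWt]
  | ℓ :: ls, [] => by rw [List.map_cons, patWeight, lapWt]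
  | ℓ :: ls, pq :: π => by
    rw [List.map_cons, patWeight_cons, lapWt, patWeight_laps_eq_lapWt x hx ls π]
    congr 1
    simp only [DelOp.weight, typeRestrict_apply, hx]
    split_ifs <;> simp

variable {deg} (K : ∀ v : Fin n, (Fin (deg v) → Γ) → 𝕜)

omit [Fintype Γ] in
/-- **Against supported kernels the type restriction is the consistency constraint**:
`kerProd · weight(x, Δ_{C|ℓ…}, π) = kerProd · lapWt`. [folklore] -/
theorem kerProd_mul_patWeight_laps (hK : ∀ v Yv, K v Yv ≠ 0 → ∀ j, cl (Yv j) = v)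
    (x : Fin (∑ v, deg v) → Γ) (ls : List (Sym2 (Fin n))) (π : List (Fin (∑ v, deg v) × Fin (∑ v, deg v))) :
    kerProd K x * patWeight x (ls.map fun ℓ => (DelOp.lap (typeRestrict C cl ℓ) : DelOp Γ 𝕜)) π = kerProd K x * lapWt C cl deg ls π x := by
  by_cases h : kerProd K x = 0
  · rw [h, zero_mul, zero_mul]
  · rw [patWeight_laps_eq_lapWt C cl deg x (cl_eq_vert_of_kerProd_ne_zero K cl hK h)]

omit [Fintype Γ] in
/-- Against supported kernels, a pinned label pins the cluster of its position. [folklore] -/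
theorem kerProd_mul_ite_eq (hK : ∀ v Yv, K v Yv ≠ 0 → ∀ j, cl (Yv j) = v)
    (x : Fin (∑ v, deg v) → Γ) (p₀ : Fin (∑ v, deg v)) (w : Γ) (a : ℝ) :
    kerProd K x * (if x p₀ = w then a else 0) = if vert deg p₀ = cl w then kerProd K x * (if x p₀ = w then a else 0) else 0 := by
  by_cases h : kerProd K x = 0
  · simp [h]
  · by_cases hp : x p₀ = w
    · have hv : vert deg p₀ = cl w := by rw [← hp]; exact (cl_eq_vert_of_kerProd_ne_zero K cl hK h p₀).symm
      rw [if_pos hv]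
    · simp [hp]

/-! ### Consistent patterns: the weights as a product over the lines -/

/-- The two-point weight of the line `ℓ` read off a zipped (line, step) list: `½‖C|_ℓ(x_q, x_p)‖` for the step
`(p, q)` of `ℓ` (and `1` if `ℓ` is absent). [folklore] -/
def lineWt (zs : List (Sym2 (Fin n) × (Fin (∑ v, deg v) × Fin (∑ v, deg v)))) (ℓ : Sym2 (Fin n)) (x : Fin (∑ v, deg v) → Γ) : ℝ :=
  match zs.find? (fun z => decide (z.1 = ℓ)) with
  | some z => 1 / 2 * ‖typeRestrict C cl ℓ (x z.2.2) (x z.2.1)‖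
  | none => 1

omit [Fintype Γ] [DecidableEq Γ] in
/-- **For distinct lines, `lapWt = [consistent] · ∏_ℓ lineWt ℓ`.** [folklore] -/
theorem lapWt_eq (x : Fin (∑ v, deg v) → Γ) : ∀ (ls : List (Sym2 (Fin n))) (π : List (Fin (∑ v, deg v) × Fin (∑ v, deg v))),
    ls.Nodup → lapWt C cl deg ls π x =
      if stepsOK (ls.map (lapPred deg)) π then (ls.map fun ℓ => lineWt C cl (ls.zip π) ℓ x).prod else 0
  | [], π, _ => by simp [lapWt, stepsOK]
  | ℓ :: ls, [], _ => by simp [lapWt, stepsOK]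
  | ℓ :: ls, pq :: π, hnd => by
    obtain ⟨hℓ, hnd'⟩ := List.nodup_cons.1 hnd
    rw [lapWt, lapWt_eq x ls π hnd', List.map_cons, stepsOK, List.zip_cons_cons, List.map_cons, List.prod_cons]
    have hhead : lineWt C cl ((ℓ, pq) :: ls.zip π) ℓ x = 1 / 2 * ‖typeRestrict C cl ℓ (x pq.2) (x pq.1)‖ := by
      rw [lineWt, List.find?_cons_of_pos (by simp)]
    have htail : (ls.map fun ℓ' => lineWt C cl ((ℓ, pq) :: ls.zip π) ℓ' x) = ls.map fun ℓ' => lineWt C cl (ls.zip π) ℓ' x := by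
      refine List.map_congr_left fun ℓ' hℓ' => ?_
      have hne : ℓ ≠ ℓ' := fun h => hℓ (h ▸ hℓ')
      rw [lineWt, lineWt, List.find?_cons_of_neg (by simp [hne])]
    rw [hhead, htail]
    by_cases hc : s(vert deg pq.2, vert deg pq.1) = ℓ
    · simp only [hc, if_true, lapPred, decide_true, Bool.true_and]
      split_ifs <;> ring
    · simp [hc, lapPred]

omit [Fintype Γ] [DecidableEq Γ] in
/-- In a consistent pattern every line has its step, found by `find?`. [folklore] -/
theorem exists_find_of_stepsOK : ∀ (ls : List (Sym2 (Fin n))) (π : List (Fin (∑ v, deg v) × Fin (∑ v, deg v))),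
    stepsOK (ls.map (lapPred deg)) π = true → ∀ ℓ ∈ ls,
      ∃ pq, (ls.zip π).find? (fun z => decide (z.1 = ℓ)) = some (ℓ, pq) ∧ s(vert deg pq.2, vert deg pq.1) = ℓ
  | [], _, _, ℓ, hℓ => absurd hℓ List.not_mem_nil
  | ℓ' :: ls, [], h, ℓ, _ => by simp [stepsOK] at h
  | ℓ' :: ls, pq :: π, h, ℓ, hℓ => by
    rw [List.map_cons, stepsOK, Bool.and_eq_true, lapPred, decide_eq_true_eq] at h
    rw [List.zip_cons_cons]
    by_cases he : ℓ' = ℓ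
    · subst he
      exact ⟨pq, by rw [List.find?_cons_of_pos (by simp)], h.1⟩
    · obtain ⟨pq', h1, h2⟩ := exists_find_of_stepsOK ls π h.2 ℓ ((List.mem_cons.1 hℓ).resolve_left (Ne.symm he))
      exact ⟨pq', by rw [List.find?_cons_of_neg (by simp [he]), h1], h2⟩

end LapWeights

/-! ### The tree-decay lemma applied -/

section TreeDecay

variable {𝕜 : Type*} [RCLike 𝕜] {Γ : Type*} [Fintype Γ] [DecidableEq Γ] {n : ℕ} (C : Matrix Γ Γ 𝕜) (cl : Γ → Fin n)
variable {deg : Fin n → ℕ} (K : ∀ v : Fin n, (Fin (deg v) → Γ) → 𝕜)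

/-- **The anchored sums of a block kernel read off position labellings**: with the slot `τ` of `u` pinned at `a`
and the positions outside `u` frozen at `0`, `Σ_x ‖K_u(x|_u)‖ ≤ N_u`. [folklore] -/
theorem sum_filter_norm_block_le [AddCommGroup Γ] (Nv : Fin n → ℝ)
    (hN : ∀ u (j : Fin (deg u)) (a : Γ), ∑ Yu ∈ univ.filter (fun Yu : Fin (deg u) → Γ => Yu j = a), ‖K u Yu‖ ≤ Nv u)
    (u : Fin n) (τ : Fin (∑ v, deg v)) (hτ : vert deg τ = u) (a : Γ) :
    ∑ x ∈ univ.filter (fun x : Fin (∑ v, deg v) → Γ => x τ = a ∧ ∀ τ', vert deg τ' ≠ u → x τ' = 0),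
      ‖K u fun j => x (blockEmb deg u j)‖ ≤ Nv u := by
  subst hτ
  set F := univ.filter (fun x : Fin (∑ v, deg v) → Γ => x τ = a ∧ ∀ τ', vert deg τ' ≠ vert deg τ → x τ' = 0) with hF
  set g : (Fin (∑ v, deg v) → Γ) → (Fin (deg (vert deg τ)) → Γ) := fun x j => x (blockEmb deg (vert deg τ) j) with hg
  have hinj : Set.InjOn g F := by
    intro x hx x' hx' hxx'
    funext i
    by_cases hi : vert deg i = vert deg τ
    · obtain ⟨j, rfl⟩ := exists_eq_blockEmb deg hi
      exact congrFun hxx' j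
    · rw [(mem_filter.1 (Finset.mem_coe.1 hx)).2.2 i hi, (mem_filter.1 (Finset.mem_coe.1 hx')).2.2 i hi]
  have hsum : ∑ x ∈ F, ‖K (vert deg τ) fun j => x (blockEmb deg (vert deg τ) j)‖ = ∑ Y ∈ F.image g, ‖K (vert deg τ) Y‖ := by
    rw [sum_image hinj]
  rw [hsum]
  refine le_trans (sum_le_sum_of_subset_of_nonneg (fun Y hY => ?_) fun _ _ _ => norm_nonneg _) (hN (vert deg τ) (finSigmaFinEquiv.symm τ).2 a)
  obtain ⟨x, hx, rfl⟩ := mem_image.1 hY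
  rw [mem_filter]
  refine ⟨mem_univ _, ?_⟩
  show x (blockEmb deg (vert deg τ) (finSigmaFinEquiv.symm τ).2) = a
  rw [blockEmb_vert]
  exact (mem_filter.1 hx).2.1

/-- **The tree-decay lemma applied to one script and one consistent pattern** (Benfatto–Giuliani–Mastropietro
2006, proof of (2.77)): for a valid script rooted at `cl w` covering all the vertices, a position `p₀` of the
root cluster pinned at `w`, kernels with anchored `L¹` norms `≤ N_u` and a covariance whose type restrictions
`C|_ℓ` have row and column sums of norms at most `α`,
`Σ_{x : x_{p₀} = w} ∏_u ‖K_u(x|_u)‖ · lapWt(lines, π, x) ≤ (α/2)^k ∏_u N_u`. [cite: BenfattoGiulianiMastropietro2006, proof of (2.77)] -/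
theorem sum_kerProd_mul_lapWt_le (Nv : Fin n → ℝ) (hN0 : ∀ u, 0 ≤ Nv u)
    (hN : ∀ u (j : Fin (deg u)) (a : Γ), ∑ Yu ∈ univ.filter (fun Yu : Fin (deg u) → Γ => Yu j = a), ‖K u Yu‖ ≤ Nv u)
    {α : ℝ} (hα : 0 ≤ α) (hrow : ∀ ℓ X, ∑ Y, ‖typeRestrict C cl ℓ X Y‖ ≤ α) (hcol : ∀ ℓ Y, ∑ X, ‖typeRestrict C cl ℓ X Y‖ ≤ α)
    {v₀ : Fin n} {k : ℕ} (s : Script v₀ k) (hs : s.Valid) (hcov : univ.image s.y = univ)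
    (π : List (Fin (∑ v, deg v) × Fin (∑ v, deg v))) (p₀ : Fin (∑ v, deg v)) (hp₀ : vert deg p₀ = v₀) (w : Γ) :
    ∑ x ∈ univ.filter (fun x : Fin (∑ v, deg v) → Γ => x p₀ = w), kerProd K x * lapWt C cl deg s.lines.reverse π x ≤
      (α / 2) ^ k * ∏ u, Nv u := by
  have hRHS : 0 ≤ (α / 2) ^ k * ∏ u, Nv u := mul_nonneg (pow_nonneg (by positivity) _) (prod_nonneg fun u _ => hN0 u)
  have hnd : s.lines.reverse.Nodup := List.nodup_reverse.2 (Script.nodup_lines s hs)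
  by_cases hc : stepsOK (s.lines.reverse.map (lapPred deg)) π = true
  swap
  · refine le_trans (le_of_eq (sum_eq_zero fun x _ => ?_)) hRHS
    rw [lapWt_eq C cl x _ π hnd, if_neg hc, mul_zero]
  -- the tree-decay lemma, in a transported (opaque) group structure of `Γ`
  haveI : Nonempty Γ := ⟨w⟩
  haveI : NeZero (Fintype.card Γ) := ⟨Fintype.card_ne_zero⟩
  obtain ⟨_instACG⟩ : Nonempty (AddCommGroup Γ) := ⟨(Fintype.equivFin Γ).addCommGroup⟩
  have hlines : ∀ ℓ ∈ s.lines, ∃ (τ₁ τ₂ : Fin (∑ v, deg v)) (h : Γ → Γ → ℝ), s(vert deg τ₁, vert deg τ₂) = ℓ ∧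
      (∀ x : Fin (∑ v, deg v) → Γ, lineWt C cl (s.lines.reverse.zip π) ℓ x = h (x τ₁) (x τ₂)) ∧ (∀ b b', 0 ≤ h b b') ∧
      (∀ b, ∑ b', h b b' ≤ α / 2) ∧ (∀ b', ∑ b, h b b' ≤ α / 2) := by
    intro ℓ hℓ
    obtain ⟨pq, hfind, hpq⟩ := exists_find_of_stepsOK (deg := deg) s.lines.reverse π hc ℓ (List.mem_reverse.2 hℓ)
    refine ⟨pq.2, pq.1, fun b b' => 1 / 2 * ‖typeRestrict C cl ℓ b b'‖, hpq, fun x => by rw [lineWt, hfind], fun b b' => by positivity,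
      fun b => ?_, fun b' => ?_⟩
    · rw [← mul_sum]; linarith [hrow ℓ b]
    · rw [← mul_sum]; linarith [hcol ℓ b']
  have hR : Nv v₀ * ((α / 2) ^ k * ∏ m : Fin k, Nv (s.y m.succ)) = (α / 2) ^ k * ∏ u, Nv u := by
    have hprod : ∏ u, Nv u = ∏ m : Fin (k + 1), Nv (s.y m) := by
      rw [← prod_image (s := univ) (g := s.y) (f := Nv) fun m _ m' _ h => Script.y_injective s hs h, hcov]
    rw [hprod, Fin.prod_univ_succ, Script.y_zero]
    ring
  -- (the tree-decay lemma was stated for a general slot type; its decidability instances are matched by `convert`)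
  have hE := sum_kernelProd_lineProd_le (Λ := Γ) (vert deg) (fun u x => ‖K u fun j => x (blockEmb deg u j)‖)
    (fun u x => norm_nonneg _)
    (fun u x x' hxx' => by
      show ‖K u fun j => x (blockEmb deg u j)‖ = ‖K u fun j => x' (blockEmb deg u j)‖
      rw [show (fun j => x (blockEmb deg u j)) = fun j => x' (blockEmb deg u j) from funext fun j => hxx' _ (vert_blockEmb deg u j)])
    Nv (fun u τ hτ a => by convert sum_filter_norm_block_le K Nv hN u τ hτ a using 3) (Γ := α / 2) (by positivity)
    (fun ℓ x => lineWt C cl (s.lines.reverse.zip π) ℓ x) s hs hlines p₀ hp₀ w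
  have hE' : ∑ x ∈ univ.filter (fun x : Fin (∑ v, deg v) → Γ => x p₀ = w ∧ ∀ τ, vert deg τ ∉ univ.image s.y → x τ = 0),
      (∏ u ∈ univ.image s.y, ‖K u fun j => x (blockEmb deg u j)‖) * (s.lines.map fun ℓ => lineWt C cl (s.lines.reverse.zip π) ℓ x).prod ≤
      Nv v₀ * ((α / 2) ^ k * ∏ m : Fin k, Nv (s.y m.succ)) := by
    convert hE using 3
  refine le_trans (le_of_eq ?_) (hE'.trans_eq hR)
  refine sum_congr (filter_congr fun x _ => ?_) fun x _ => ?_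
  · simp [hcov]
  · rw [hcov, lapWt_eq C cl x _ π hnd, if_pos hc, List.map_reverse, List.prod_reverse]
    rfl

end TreeDecay

end Literature.MathematicalPhysics.QuantumLattice
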